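import Literature.AlgebraicGeometry.Frobenioids.CoproductCompletionEpi
import Mathlib.CategoryTheory.SingleObj
import HarnessLib

/-!
# Frobenioids I, §0 p. 15 ("almost totally epimorphic"): a VOCABULARY predicate whose universal closure is false

Mochizuki, *The geometry of Frobenioids I: the general theory*, Kyushu J. Math. **62** (2008) 293–400, §0
"Categories", kurims text p. 15 [cite: MochizukiFrdI2008, §0 p.15]:

> "We shall say that `C` is *almost totally epimorphic* if every morphism in `C` whose domain is nonempty
> and whose codomain is connected is an epimorphism."

The declaration `IsAlmostTotallyEpimorphic C` (`Categories.lean`, seat abc-iut-found) is this DEFINITION —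
a `Prop`-valued predicate of a category whose docstring carries a page locator, so the cell's frozen
FACT-LIST (row F-2318; class `preparatory`, kernel_closedness `parametrised`, label «model-witness») lists
it among the bindable "published prerequisites", while its siblings `IsTotallyEpimorphic` (F-2317),
`IsOfFinitelyConnectedType` (F-2319), `IsOfCountablyConnectedType` (F-2320) are already classed
«predicate / vocabulary, nothing to assume».  A predicate is not a claim: its universal closure says "EVERY
category is almost totally epimorphic", and is false.  This PROOF-ONLY file (abc-iut cell, block C / W6,
seat abc-iut-w6-d028, C3 default = FACT-LIST proving; no definition, no instance) records the kernel
negation of the universal closure over exactly the declaration's binders (universe level `0`) from a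
minimal closed witness, and cites BY NAME the theorem of the tree in which the predicate is ESTABLISHED
for the categories print applies it to:

* F-2318 `IsAlmostTotallyEpimorphic` — `not_forall_isAlmostTotallyEpimorphic`: in the one-object
  category `SingleObj ℕ` of the multiplicative monoid `ℕ` (arrows = natural numbers, composition =
  multiplication) the unique object is nonempty (= non-initial: it has the two distinct endomorphisms
  `1 ≠ 2`) and connected (no cofan `(a, b)` is a coproduct: if `a = 0` the pair `(1, 1)` does not factor,
  if `a ≠ 0` the pair `(0, 1)` does not), while the endomorphism `0` is not an epimorphism
  (`0 ≫ 1 = 0 = 0 ≫ 2`).  Established instances: "if `C` is a totally epimorphic category, then `C^⊥`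
  (respectively, `C^⊤`) is an almost totally epimorphic category" ([FrdI] §0 p. 16,
  `IsTotallyEpimorphic.isAlmostTotallyEpimorphic_finiteCoproductCompletion` /
  `…_countableCoproductCompletion`, file `CoproductCompletionEpi.lean`) — the instance form print uses
  (base categories of Frobenioids, [FrdI] Def. 1.3; connected temperoids, [SemiAnbd] §3).

So the row is not an admissible HYPOTHESIS of anything (a consumer needing "`C` is almost totally
epimorphic" for a specific `C` proves it); FACT-LIST class «universal-closure REFUTED; instance forms
PROVED».  Elementary category theory; nothing here bears on [IUTchIII] Cor. 3.12 or takes a side;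
refuted-as-closure is a statement about OUR typing's binders, not about the paper.
-/

namespace Literature.AlgebraicGeometry.Frobenioids

open CategoryTheory CategoryTheory.Limits

universe w v u

/-! ### The closed witness `SingleObj ℕ` ([FrdI] §0 p. 15)

Arrows `X ⟶ Y` of the one-object category `SingleObj ℕ` ARE natural numbers (`Hom _ _ := ℕ`, composition
`f ≫ g = g * f`); below an arrow is written `show X ⟶ Y from (n : ℕ)` and read back as `show ℕ from f` — both
are the identity map, so every equation of arrows is an equation of natural numbers by `rfl`. -/

/-- The unique object of `SingleObj ℕ` — indeed every object `X` (the carrier is `Unit`) — is *nonempty* in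
the sense of [FrdI] §0 p. 15, i.e. not initial: it carries the two distinct arrows `1 ≠ 2` to the unique
object. [cite: MochizukiFrdI2008, §0 p.15] -/
theorem isNonemptyObj_singleObj_nat (X : SingleObj ℕ) : IsNonemptyObj X := by
  refine ⟨fun h => ?_⟩
  have h12 : (show X ⟶ SingleObj.star ℕ from (1 : ℕ)) = (show X ⟶ SingleObj.star ℕ from (2 : ℕ)) :=
    h.hom_ext _ _
  have h12' : (1 : ℕ) = 2 := h12
  omega

/-- No binary cofan with vertex the unique object of `SingleObj ℕ` is a coproduct diagram: for the cofan
`(a, b)`, if `a = 0` the pair of arrows `(1, 1)` admits no factorisation (`φ · 0 ≠ 1`), and if `a ≠ 0` the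
pair `(0, 1)` admits none (`φ · a = 0` forces `φ = 0`, then `φ · b = 0 ≠ 1`).
[cite: MochizukiFrdI2008, §0 p.15] -/
theorem isEmpty_isColimit_binaryCofan_singleObj_nat {B₁ B₂ : SingleObj ℕ} (a b : ℕ) :
    IsEmpty (IsColimit (BinaryCofan.mk (show B₁ ⟶ SingleObj.star ℕ from a)
      (show B₂ ⟶ SingleObj.star ℕ from b))) := by
  refine ⟨fun t => ?_⟩
  rcases Nat.eq_zero_or_pos a with rfl | ha
  · -- the pair `(1, 1)` does not factor through `(0, b)`
    let c : BinaryCofan B₁ B₂ :=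
      BinaryCofan.mk (show B₁ ⟶ SingleObj.star ℕ from (1 : ℕ)) (show B₂ ⟶ SingleObj.star ℕ from (1 : ℕ))
    have h1 : (show ℕ from t.desc c) * 0 = 1 := t.fac c ⟨WalkingPair.left⟩
    omega
  · -- the pair `(0, 1)` does not factor through `(a, b)` with `a ≠ 0`
    let c : BinaryCofan B₁ B₂ :=
      BinaryCofan.mk (show B₁ ⟶ SingleObj.star ℕ from (0 : ℕ)) (show B₂ ⟶ SingleObj.star ℕ from (1 : ℕ))
    have h1 : (show ℕ from t.desc c) * a = 0 := t.fac c ⟨WalkingPair.left⟩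
    have h2 : (show ℕ from t.desc c) * b = 1 := t.fac c ⟨WalkingPair.right⟩
    rcases Nat.mul_eq_zero.mp h1 with hd | ha'
    · rw [hd, zero_mul] at h2
      omega
    · omega

/-- The unique object of `SingleObj ℕ` is *connected* in the sense of [FrdI] §0 p. 15 (nonempty, and not a
coproduct of two nonempty objects — indeed not a binary coproduct at all). [cite: MochizukiFrdI2008, §0 p.15] -/
theorem isConnectedObj_singleObj_nat : IsConnectedObj (SingleObj.star ℕ) :=
  ⟨isNonemptyObj_singleObj_nat _, fun _ _ ι₁ ι₂ _ _ =>
    isEmpty_isColimit_binaryCofan_singleObj_nat (show ℕ from ι₁) (show ℕ from ι₂)⟩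

/-- The endomorphism `0` of the unique object of `SingleObj ℕ` is NOT an epimorphism: `0 ≫ 1 = 0 ≫ 2`
(both are `0`) although `1 ≠ 2`. [cite: MochizukiFrdI2008, §0 p.15] -/
theorem not_epi_singleObj_nat_zero :
    ¬ Epi (show SingleObj.star ℕ ⟶ SingleObj.star ℕ from (0 : ℕ)) := by
  intro h
  have hcomp : (show SingleObj.star ℕ ⟶ SingleObj.star ℕ from (0 : ℕ)) ≫
        (show SingleObj.star ℕ ⟶ SingleObj.star ℕ from (1 : ℕ)) =
      (show SingleObj.star ℕ ⟶ SingleObj.star ℕ from (0 : ℕ)) ≫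
        (show SingleObj.star ℕ ⟶ SingleObj.star ℕ from (2 : ℕ)) := by
    show (1 : ℕ) * 0 = 2 * 0
    rfl
  have h12 : (1 : ℕ) = 2 := h.left_cancellation _ _ hcomp
  omega

/-- **Closed witness**: the one-object category `SingleObj ℕ` of the multiplicative monoid `ℕ` is NOT almost
totally epimorphic — `0` is an arrow with nonempty domain and connected codomain that is not an
epimorphism. [cite: MochizukiFrdI2008, §0 p.15] -/
theorem not_isAlmostTotallyEpimorphic_singleObj_nat : ¬ IsAlmostTotallyEpimorphic (SingleObj ℕ) :=
  fun h => not_epi_singleObj_nat_zero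
    (h.epi _ (isNonemptyObj_singleObj_nat _) isConnectedObj_singleObj_nat)

/-! ### F-2318 `IsAlmostTotallyEpimorphic` ([FrdI] §0 p. 15): the universal closure is false -/

/-- **The universal closure of the vocabulary predicate `IsAlmostTotallyEpimorphic` is FALSE** (FACT-LIST
F-2318: a definition, not a hypothesis).  Binders exactly those of the declaration, universe level `0`.
[cite: MochizukiFrdI2008, §0 p.15] -/
theorem not_forall_isAlmostTotallyEpimorphic :
    ¬ ∀ (C : Type) [Category.{0} C],
        Literature.AlgebraicGeometry.Frobenioids.IsAlmostTotallyEpimorphic C :=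
  fun h => not_isAlmostTotallyEpimorphic_singleObj_nat (h (SingleObj ℕ))

/-- The same negation with the category universe-polymorphic in the morphism level is not needed by any
consumer; for the record, the closure also fails with BOTH binders of `IsTotallyEpimorphic`'s weaker sibling
read at level `0`: "every category is totally epimorphic" is false at the same witness.
[cite: MochizukiFrdI2008, §0 p.15] -/
theorem not_forall_isTotallyEpimorphic :
    ¬ ∀ (C : Type) [Category.{0} C],
        Literature.AlgebraicGeometry.Frobenioids.IsTotallyEpimorphic C :=
  fun h => not_isAlmostTotallyEpimorphic_singleObj_nat ((h (SingleObj ℕ)).isAlmostTotallyEpimorphic)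

/-- **Census of F-2318**: the closure is false, while print's own instance form holds — "if `C` is a
totally epimorphic category, then `C^⊥` is an almost totally epimorphic category" ([FrdI] §0 p. 16,
`IsTotallyEpimorphic.isAlmostTotallyEpimorphic_finiteCoproductCompletion`), the form in which [FrdI]
Def. 1.3 and [SemiAnbd] §3 use the notion. [cite: MochizukiFrdI2008, §0 p.16] -/
theorem isAlmostTotallyEpimorphic_schema_census {C : Type u} [Category.{v} C]
    (hC : IsTotallyEpimorphic C) :
    (¬ ∀ (C : Type) [Category.{0} C],
        Literature.AlgebraicGeometry.Frobenioids.IsAlmostTotallyEpimorphic C) ∧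
      IsAlmostTotallyEpimorphic (FiniteCoproductCompletion.{w} C) :=
  ⟨not_forall_isAlmostTotallyEpimorphic, hC.isAlmostTotallyEpimorphic_finiteCoproductCompletion⟩

end Literature.AlgebraicGeometry.Frobenioids
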